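import Mathlib.MeasureTheory.Integral.MeanInequalities
import Mathlib.MeasureTheory.Integral.IntervalIntegral.FundThmCalculus
import Mathlib.Analysis.SpecialFunctions.Integrals.Basic
import Mathlib.Analysis.SpecialFunctions.Pow.NNReal
import Literature.Analysis.FluidPDE.LerayVolterraComparison
import HarnessLib

/-!
# The fractional Grönwall inequality of Coiculescu–Palasek
# `f(t) ≤ a + ∫_{t₀}^t (g₁(s) + (t - s)^{-1/2} g₂(s)) f(s) ds  ⟹  f ≤ 3a·exp(3∫g₁ + O(M)∫g₂²)`

Analysis/FluidPDE support file (pure real analysis; everything proved, no definitions, no named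
facts) on the discharge path of the named fact
`Literature.Barriers.NavierStokesRegularity.CoiculescuPalasek2025_perturbation`
(`Barriers/NavierStokesRegularity/CriticalDataSmoothNonuniquenessConstruction.lean`: the
perturbation theorem, Props. 4.2–4.3 with App. B of M. P. Coiculescu, S. Palasek, *Non-uniqueness
of smooth solutions of the Navier–Stokes equations from critical data*, Invent. Math. 244 (2025),
arXiv:2503.14699). The semigroup bounds of its Prop. 4.2 rest on the **fractional Grönwall
inequality** of App. B, Lemma B.3 (= Lemma 7.3 of the arXiv version): if positive functions obey
`f(t) ≤ a(t) + ∫_{t₀}^t (g₁(s) + (t-s)^{-1/2} g₂(s)) f(s) ds` with `a` non-decreasing, then for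
`p > 2`,
`f(t) ≲_p a(t) exp(O_p(∫_{t₀}^t g₁ + ‖s^{1/2} g₂‖^{p-2}_{L^∞[t₀,t]} ∫_{t₀}^t g₂²))` — "the extra factor
`‖s^{1/2}g₂‖_{L^∞}` in the exponential reflects the failure of the Hardy–Littlewood–Sobolev
inequality at the `L^∞` endpoint". This file proves it with `p = 3` and explicit constants:

* `setIntegral_abel_rpow_rpow_le` — the two-sided Abel–Beta bound
  `∫_{(0,t)} (t-s)^{-a} s^{-b} ds ≤ (2/(1-b) + 2/(1-a)) t^{1-a-b}` (`a, b ∈ [0,1)`; split at `t/2`),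
  generalising the tree's `setIntegral_abel_rpow_le` (`a = 1/2`), and its scale-free case
  `a + b = 1` on `(t₀, τ)`, `0 ≤ t₀` (`setIntegral_abel_rpow_rpow_le_of_add_eq_one`);
* `integral_mul_exp_primitive_eq` / `_le` — `∫_{t₀}^τ λ φ e^{λΦ} = e^{λΦ(τ)} - 1` for the
  primitive `Φ(t) = ∫_{t₀}^t φ` of a continuous `φ` (FTC), and the resulting bound for `0 ≤ ψ ≤ φ`;
* `integral_abel_mul_pow_three_le` — the Hölder step of the printed proof in the endpoint form
  `(∫_{(t₀,τ)} (τ-s)^{-1/2} h E)³ ≤ (32/3)² M ∫_{(t₀,τ)} h² E³` whenever `√s·h(s) ≤ M`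
  (Hölder with exponents `3/2, 3` on `[(τ-s)^{-1/2}s^{-1/6}]·[s^{1/6} h E]`);
* `fractional_gronwall_const`, `fractional_gronwall` — **Lemma B.3 with `p = 3`**:
  `f(t) ≤ 3 a(t) exp(3 ∫_{t₀}^t (g₁ + (8192/3) M g₂²))` on `[t₀, T]`, for `f ≥ 0` measurable and
  bounded (NO continuity of `f` is required), `g₁, g₂ ≥ 0` continuous, `√s g₂(s) ≤ M`, `0 ≤ t₀`,
  and `a ≥ 0` constant, resp. non-decreasing.

Proof (a "no first failure" argument which merges the paper's Lemma B.2 — the nonlinear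
Grönwall inequality proved there by continuity — with the Hölder reduction of Lemma B.3): with
`Φ(t) = ∫_{t₀}^t (g₁ + L g₂²)`, `L = (8192/3)M`, the candidate majorant `F = 3a e^{3Φ}` satisfies
`a + ∫_{t₀}^τ (g₁(s) + (τ-s)^{-1/2}g₂(s)) F(s) ds ≤ F(τ)/2` for every `τ` (the `g₁`-part integrates
to `a(e^{3Φ(τ)} - 1)` by the chain rule; the singular part is at most `F(τ)/6` by the Hölder step
and `∫ g₂² e^{9Φ} ≤ e^{9Φ(τ)}/(9L)`). If `f ≤ F` on `[t₀, τ)`, then for `t ∈ [τ, τ + δ]` the memory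
integral over `[t₀, τ)` is at most its value at `t = τ` (the kernel decreases in `t`), and the part
over `[τ, t]` is `O(√δ)` by boundedness of `f`; so `f ≤ F` on `[t₀, τ + δ]` with `δ` independent of
`τ`, and `sup {τ : f ≤ F on [t₀, τ]} = T`. Constants are not optimised.

## Mathlib / tree search

Mathlib has the differential Grönwall inequality (`Mathlib.Analysis.ODE.Gronwall`, `gronwallBound`)
and Hölder's inequality for `lintegral` (`ENNReal.lintegral_mul_le_Lp_mul_Lq`), no Volterra /
weakly-singular Grönwall lemma; the tree has the integral form
(`Literature.Analysis.FunctionSpaces.gronwall_of_le_integral`), the Abel–Beta bound and a comparison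
principle for Leray's quadratic Volterra inequality (`LerayVolterraComparison.lean`, imported for
`integrableOn_sub_rpow_Ioo`, `integrableOn_rpow_Ioo`, `setIntegral_Ioo_rpow_neg`), nothing fractional.

## References

* M. P. Coiculescu, S. Palasek, Invent. Math. 244 (2025) 165–219, doi:10.1007/s00222-025-01396-z,
  arXiv:2503.14699: App. B, Lemmas B.2–B.3 (= §7.2, Lemmas 7.2–7.3 of the arXiv version), used in
  the proof of Prop. 4.2. [CoiculescuPalasek2025]
* J. R. L. Webb, *A fractional Gronwall inequality and the asymptotic behaviour of global solutions
  of Caputo fractional problems*, Electron. J. Qual. Theory Differ. Equ. 2021, No. 80 (cited there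
  for the family of such inequalities).
-/

noncomputable section

open MeasureTheory Set Filter
open _root_.Topology
open scoped ENNReal NNReal

namespace Literature.Analysis.FluidPDE

/-! ### Two-sided Abel–Beta bounds -/

/-- `∫_{(c,t)} (t - s)^{-a} ds = (t - c)^{1-a}/(1-a)` for `c ≤ t` and `a < 1`. [folklore] -/
theorem setIntegral_Ioo_sub_rpow_neg {c t a : ℝ} (hct : c ≤ t) (ha : a < 1) :
    ∫ s in Ioo c t, (t - s) ^ (-a) = (t - c) ^ (1 - a) / (1 - a) := by
  rw [← integral_Ioc_eq_integral_Ioo, ← intervalIntegral.integral_of_le hct,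
    intervalIntegral.integral_comp_sub_left (fun s : ℝ => s ^ (-a)) t, sub_self,
    integral_rpow (Or.inl (by linarith))]
  have h1 : -a + 1 = 1 - a := by ring
  rw [h1, Real.zero_rpow (by linarith), sub_zero]

/-- **Two-sided Abel–Beta bound.** For `a, b ∈ [0, 1)` and `0 < t`,
`∫_{(0,t)} (t - s)^{-a} s^{-b} ds ≤ (2/(1-b) + 2/(1-a)) t^{1-a-b}`, and the integrand is integrable
on `(0, t)` (split at `t/2`: on `(0, t/2]` the kernel is at most `(t/2)^{-a}`, on `(t/2, t)` the
weight is at most `(t/2)^{-b}`; `(t/2)^{1-a-b} ≤ 2 t^{1-a-b}`). The exact value is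
`B(1-a, 1-b) t^{1-a-b}`; only the order is needed. [folklore] -/
theorem setIntegral_abel_rpow_rpow_le {a b t : ℝ} (ha0 : 0 ≤ a) (ha : a < 1) (hb0 : 0 ≤ b)
    (hb : b < 1) (ht : 0 < t) :
    IntegrableOn (fun s : ℝ => (t - s) ^ (-a) * s ^ (-b)) (Ioo 0 t) ∧
      ∫ s in Ioo 0 t, (t - s) ^ (-a) * s ^ (-b) ≤ (2 / (1 - b) + 2 / (1 - a)) * t ^ (1 - a - b) := by
  have ht2 : 0 < t / 2 := by positivity
  have h1a : 0 < 1 - a := by linarith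
  have h1b : 0 < 1 - b := by linarith
  set I₁ : Set ℝ := Ioc 0 (t / 2) with hI₁
  set I₂ : Set ℝ := Ioo (t / 2) t with hI₂
  have hunion : I₁ ∪ I₂ = Ioo 0 t := Ioc_union_Ioo_eq_Ioo ht2.le (by linarith)
  have hdisj : Disjoint I₁ I₂ := by
    rw [hI₁, hI₂, Set.disjoint_left]
    intro s hs hs'
    exact absurd hs'.1 (not_lt.2 hs.2)
  set f : ℝ → ℝ := fun s => (t - s) ^ (-a) * s ^ (-b) with hf
  have hmk : Measurable fun s : ℝ => (t - s) ^ (-a) := measurable_sub_rpow_const t _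
  have hmw : Measurable fun s : ℝ => s ^ (-b) := measurable_id.pow_const _
  -- piece 1: kernel bounded by `(t/2)^{-a}`, weight integrable
  have hk1 : ∀ s ∈ I₁, (t - s) ^ (-a) ≤ (t / 2) ^ (-a) := fun s hs =>
    Real.rpow_le_rpow_of_nonpos ht2 (by linarith [hs.2]) (by linarith)
  have hk1' : ∀ s ∈ I₁, 0 ≤ (t - s) ^ (-a) := fun s hs =>
    Real.rpow_nonneg (by linarith [hs.2]) _
  have hw1 : IntegrableOn (fun s : ℝ => s ^ (-b)) I₁ := by
    have h := intervalIntegral.intervalIntegrable_rpow' (show -1 < -b by linarith) (a := 0)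
      (b := t / 2)
    rwa [intervalIntegrable_iff_integrableOn_Ioc_of_le ht2.le] at h
  have hint1 : IntegrableOn f I₁ := by
    refine Integrable.bdd_mul (c := (t / 2) ^ (-a)) hw1 hmk.aestronglyMeasurable ?_
    refine (ae_restrict_iff' measurableSet_Ioc).2 (Eventually.of_forall fun s hs => ?_)
    rw [Real.norm_of_nonneg (hk1' s hs)]
    exact hk1 s hs
  -- piece 2: weight bounded by `(t/2)^{-b}`, kernel integrable
  have hw2 : ∀ s ∈ I₂, s ^ (-b) ≤ (t / 2) ^ (-b) := fun s hs =>
    Real.rpow_le_rpow_of_nonpos ht2 hs.1.le (by linarith)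
  have hw2' : ∀ s ∈ I₂, 0 ≤ s ^ (-b) := fun s hs => Real.rpow_nonneg (ht2.trans hs.1).le _
  have hk2 : IntegrableOn (fun s : ℝ => (t - s) ^ (-a)) I₂ :=
    integrableOn_sub_rpow_Ioo (by linarith)
  have hint2 : IntegrableOn f I₂ := by
    refine Integrable.mul_bdd (c := (t / 2) ^ (-b)) hk2 hmw.aestronglyMeasurable ?_
    refine (ae_restrict_iff' measurableSet_Ioo).2 (Eventually.of_forall fun s hs => ?_)
    rw [Real.norm_of_nonneg (hw2' s hs)]
    exact hw2 s hs
  have hint : IntegrableOn f (Ioo 0 t) := by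
    rw [← hunion]
    exact hint1.union hint2
  refine ⟨hint, ?_⟩
  have hsplit : ∫ s in Ioo 0 t, f s = (∫ s in I₁, f s) + ∫ s in I₂, f s := by
    rw [← hunion]
    exact setIntegral_union hdisj measurableSet_Ioo hint1 hint2
  have hb1 : ∫ s in I₁, f s ≤ (t / 2) ^ (-a) * ((t / 2) ^ (1 - b) / (1 - b)) := by
    calc ∫ s in I₁, f s ≤ ∫ s in I₁, (t / 2) ^ (-a) * s ^ (-b) := by
          refine setIntegral_mono_on hint1 (hw1.const_mul _) measurableSet_Ioc fun s hs => ?_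
          exact mul_le_mul_of_nonneg_right (hk1 s hs) (Real.rpow_nonneg hs.1.le _)
      _ = (t / 2) ^ (-a) * ((t / 2) ^ (1 - b) / (1 - b)) := by
          rw [integral_const_mul, hI₁, integral_Ioc_eq_integral_Ioo,
            setIntegral_Ioo_rpow_neg ht2.le hb]
  have hb2 : ∫ s in I₂, f s ≤ (t / 2) ^ (-b) * ((t - t / 2) ^ (1 - a) / (1 - a)) := by
    calc ∫ s in I₂, f s ≤ ∫ s in I₂, (t / 2) ^ (-b) * (t - s) ^ (-a) := by
          refine setIntegral_mono_on hint2 (hk2.const_mul _) measurableSet_Ioo fun s hs => ?_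
          rw [hf]
          dsimp only
          rw [mul_comm]
          exact mul_le_mul_of_nonneg_right (hw2 s hs) (Real.rpow_nonneg (by linarith [hs.2]) _)
      _ = (t / 2) ^ (-b) * ((t - t / 2) ^ (1 - a) / (1 - a)) := by
          rw [integral_const_mul, hI₂, setIntegral_Ioo_sub_rpow_neg (by linarith) ha]
  -- simplify the two bounds to multiples of `(t/2)^{1-a-b}`
  have e1 : (t / 2) ^ (-a) * ((t / 2) ^ (1 - b) / (1 - b)) =
      (1 / (1 - b)) * (t / 2) ^ (1 - a - b) := by
    rw [mul_div_assoc', ← Real.rpow_add ht2]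
    have : -a + (1 - b) = 1 - a - b := by ring
    rw [this]
    ring
  have e2 : (t / 2) ^ (-b) * ((t - t / 2) ^ (1 - a) / (1 - a)) =
      (1 / (1 - a)) * (t / 2) ^ (1 - a - b) := by
    have : t - t / 2 = t / 2 := by ring
    rw [this, mul_div_assoc', ← Real.rpow_add ht2]
    have : -b + (1 - a) = 1 - a - b := by ring
    rw [this]
    ring
  have hhalf : (t / 2) ^ (1 - a - b) ≤ 2 * t ^ (1 - a - b) := by
    rw [Real.div_rpow ht.le zero_le_two, div_le_iff₀ (Real.rpow_pos_of_pos two_pos _)]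
    have h2 : (2 : ℝ) ^ (-1 : ℝ) ≤ 2 ^ (1 - a - b) :=
      Real.rpow_le_rpow_of_exponent_le one_le_two (by linarith)
    rw [Real.rpow_neg_one] at h2
    have h3 : 0 ≤ t ^ (1 - a - b) := Real.rpow_nonneg ht.le _
    have h4 : (0 : ℝ) ≤ 2 * 2 ^ (1 - a - b) - 1 := by
      have : (2 : ℝ)⁻¹ = 1 / 2 := by norm_num
      linarith
    nlinarith [mul_nonneg h3 h4]
  have hpos : 0 ≤ (t / 2) ^ (1 - a - b) := Real.rpow_nonneg ht2.le _
  calc ∫ s in Ioo 0 t, f s = (∫ s in I₁, f s) + ∫ s in I₂, f s := hsplit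
    _ ≤ (1 / (1 - b)) * (t / 2) ^ (1 - a - b) + (1 / (1 - a)) * (t / 2) ^ (1 - a - b) := by
        rw [← e1, ← e2]; exact add_le_add hb1 hb2
    _ = (1 / (1 - b) + 1 / (1 - a)) * (t / 2) ^ (1 - a - b) := by ring
    _ ≤ (1 / (1 - b) + 1 / (1 - a)) * (2 * t ^ (1 - a - b)) :=
        mul_le_mul_of_nonneg_left hhalf (by positivity)
    _ = (2 / (1 - b) + 2 / (1 - a)) * t ^ (1 - a - b) := by ring

/-- **Scale-free two-sided Abel–Beta bound.** For `a, b ∈ [0,1)` with `a + b = 1` and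
`0 ≤ t₀`, the integrand `(τ - s)^{-a} s^{-b}` is integrable on `(t₀, τ)` and
`∫_{(t₀,τ)} (τ - s)^{-a} s^{-b} ds ≤ 2/(1-b) + 2/(1-a)`, uniformly in `t₀ ≤ τ` (monotonicity in the
domain and `setIntegral_abel_rpow_rpow_le`; the exact value over `(0, τ)` is `π / sin(πa)`, as
recalled in the printed proof of Lemma B.3). [cite: CoiculescuPalasek2025, App. B, proof of Lemma B.3] -/
theorem setIntegral_abel_rpow_rpow_le_of_add_eq_one {a b t₀ τ : ℝ} (ha0 : 0 ≤ a) (ha : a < 1)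
    (hb0 : 0 ≤ b) (hb : b < 1) (hab : a + b = 1) (ht₀ : 0 ≤ t₀) :
    IntegrableOn (fun s : ℝ => (τ - s) ^ (-a) * s ^ (-b)) (Ioo t₀ τ) ∧
      ∫ s in Ioo t₀ τ, (τ - s) ^ (-a) * s ^ (-b) ≤ 2 / (1 - b) + 2 / (1 - a) := by
  have h1a : 0 < 1 - a := by linarith
  have h1b : 0 < 1 - b := by linarith
  have hC : 0 ≤ 2 / (1 - b) + 2 / (1 - a) := by positivity
  rcases le_or_gt τ t₀ with hτ | hτ
  · rw [Ioo_eq_empty (not_lt.2 hτ)]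
    refine ⟨integrableOn_empty, ?_⟩
    rw [Measure.restrict_empty, integral_zero_measure]
    exact hC
  have hτ0 : 0 < τ := ht₀.trans_lt hτ
  obtain ⟨hint, hle⟩ := setIntegral_abel_rpow_rpow_le ha0 ha hb0 hb hτ0
  have hsub : Ioo t₀ τ ⊆ Ioo 0 τ := Ioo_subset_Ioo ht₀ le_rfl
  refine ⟨hint.mono_set hsub, ?_⟩
  have hnn : 0 ≤ᵐ[volume.restrict (Ioo 0 τ)] fun s : ℝ => (τ - s) ^ (-a) * s ^ (-b) := by
    refine (ae_restrict_iff' measurableSet_Ioo).2 (Eventually.of_forall fun s hs => ?_)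
    exact mul_nonneg (Real.rpow_nonneg (by linarith [hs.2]) _) (Real.rpow_nonneg hs.1.le _)
  calc ∫ s in Ioo t₀ τ, (τ - s) ^ (-a) * s ^ (-b)
      ≤ ∫ s in Ioo 0 τ, (τ - s) ^ (-a) * s ^ (-b) :=
        setIntegral_mono_set hint hnn (Eventually.of_forall hsub)
    _ ≤ (2 / (1 - b) + 2 / (1 - a)) * τ ^ (1 - a - b) := hle
    _ = 2 / (1 - b) + 2 / (1 - a) := by
        have : 1 - a - b = 0 := by linarith
        rw [this, Real.rpow_zero, mul_one]

/-! ### The exponential of a primitive -/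

/-- **Chain rule for the exponential of a primitive.** For `φ` continuous on `[t₀, T]` and
`s ∈ (t₀, T)`, `t ↦ exp(c ∫_{t₀}^t φ)` has derivative `c φ(s) exp(c ∫_{t₀}^s φ)` at `s`
(FTC-1 `intervalIntegral.integral_hasDerivAt_right` and the chain rule). [folklore] -/
theorem hasDerivAt_exp_mul_primitive {φ : ℝ → ℝ} {t₀ T s : ℝ} (hφ : ContinuousOn φ (Icc t₀ T))
    (hs : s ∈ Ioo t₀ T) (c : ℝ) :
    HasDerivAt (fun t => Real.exp (c * ∫ x in t₀..t, φ x))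
      (c * φ s * Real.exp (c * ∫ x in t₀..s, φ x)) s := by
  have hsT : Icc t₀ s ⊆ Icc t₀ T := Icc_subset_Icc le_rfl hs.2.le
  have hint : IntervalIntegrable φ volume t₀ s :=
    (hφ.mono hsT).intervalIntegrable_of_Icc hs.1.le
  have hmeas : StronglyMeasurableAtFilter φ (𝓝 s) volume :=
    ContinuousOn.stronglyMeasurableAtFilter isOpen_Ioo (hφ.mono Ioo_subset_Icc_self) s hs
  have hcont : ContinuousAt φ s := hφ.continuousAt (Icc_mem_nhds hs.1 hs.2)
  have hprim : HasDerivAt (fun t => ∫ x in t₀..t, φ x) (φ s) s :=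
    intervalIntegral.integral_hasDerivAt_right hint hmeas hcont
  have h := ((hprim.const_mul c).exp)
  convert h using 1
  ring

/-- **`∫_{t₀}^τ c φ e^{cΦ} = e^{cΦ(τ)} - 1`** for the primitive `Φ(t) = ∫_{t₀}^t φ` of a function
`φ` continuous on `[t₀, T]` and `τ ∈ [t₀, T]` (FTC-2 for `e^{cΦ}`, which is continuous on
`[t₀, τ]` and differentiable inside, `Φ(t₀) = 0`). [folklore] -/
theorem integral_mul_exp_primitive_eq {φ : ℝ → ℝ} {t₀ T τ : ℝ} (hφ : ContinuousOn φ (Icc t₀ T))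
    (hτ : τ ∈ Icc t₀ T) (c : ℝ) :
    ∫ s in t₀..τ, c * φ s * Real.exp (c * ∫ x in t₀..s, φ x) =
      Real.exp (c * ∫ x in t₀..τ, φ x) - 1 := by
  have hτT : Icc t₀ τ ⊆ Icc t₀ T := Icc_subset_Icc le_rfl hτ.2
  have hφτ : ContinuousOn φ (Icc t₀ τ) := hφ.mono hτT
  -- continuity of the primitive and of its exponential on `[t₀, τ]`
  have hprim : ContinuousOn (fun t => ∫ x in t₀..t, φ x) (Icc t₀ τ) := by
    have h := intervalIntegral.continuousOn_primitive_interval (μ := volume) (f := φ) (a := t₀)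
      (b := τ) (by rw [uIcc_of_le hτ.1]; exact hφτ.integrableOn_Icc)
    rwa [uIcc_of_le hτ.1] at h
  have hcont : ContinuousOn (fun t => Real.exp (c * ∫ x in t₀..t, φ x)) (Icc t₀ τ) :=
    Real.continuous_exp.comp_continuousOn (hprim.const_smul c)
  have hderiv : ∀ s ∈ Ioo t₀ τ, HasDerivAt (fun t => Real.exp (c * ∫ x in t₀..t, φ x))
      (c * φ s * Real.exp (c * ∫ x in t₀..s, φ x)) s := fun s hs =>
    hasDerivAt_exp_mul_primitive hφ ⟨hs.1, hs.2.trans_le hτ.2⟩ c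
  have hint : IntervalIntegrable (fun s => c * φ s * Real.exp (c * ∫ x in t₀..s, φ x))
      volume t₀ τ := by
    refine ContinuousOn.intervalIntegrable_of_Icc hτ.1 ?_
    exact ((continuousOn_const.mul hφτ).mul hcont)
  rw [intervalIntegral.integral_eq_sub_of_hasDerivAt_of_le hτ.1 hcont hderiv hint,
    intervalIntegral.integral_same, mul_zero, Real.exp_zero]

/-- **`∫_{t₀}^τ ψ e^{cΦ} ≤ (e^{cΦ(τ)} - 1)/c`** for `ψ ≤ φ` continuous on `[t₀, T]`, `c > 0`,
`Φ(t) = ∫_{t₀}^t φ`, `τ ∈ [t₀, T]` (monotonicity of the integral and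
`integral_mul_exp_primitive_eq`). [folklore] -/
theorem integral_mul_exp_primitive_le {φ ψ : ℝ → ℝ} {t₀ T τ c : ℝ} (hφ : ContinuousOn φ (Icc t₀ T))
    (hψ : ContinuousOn ψ (Icc t₀ T))
    (hψφ : ∀ s ∈ Icc t₀ T, ψ s ≤ φ s) (hτ : τ ∈ Icc t₀ T) (hc : 0 < c) :
    ∫ s in t₀..τ, ψ s * Real.exp (c * ∫ x in t₀..s, φ x) ≤
      (Real.exp (c * ∫ x in t₀..τ, φ x) - 1) / c := by
  have hτT : Icc t₀ τ ⊆ Icc t₀ T := Icc_subset_Icc le_rfl hτ.2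
  have hprim : ContinuousOn (fun t => ∫ x in t₀..t, φ x) (Icc t₀ τ) := by
    have h := intervalIntegral.continuousOn_primitive_interval (μ := volume) (f := φ) (a := t₀)
      (b := τ) (by rw [uIcc_of_le hτ.1]; exact (hφ.mono hτT).integrableOn_Icc)
    rwa [uIcc_of_le hτ.1] at h
  have hE : ContinuousOn (fun t => Real.exp (c * ∫ x in t₀..t, φ x)) (Icc t₀ τ) :=
    Real.continuous_exp.comp_continuousOn (hprim.const_smul c)
  rw [le_div_iff₀ hc, ← integral_mul_exp_primitive_eq hφ hτ c, mul_comm,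
    ← intervalIntegral.integral_const_mul]
  refine intervalIntegral.integral_mono_on hτ.1 ?_ ?_ fun s hs => ?_
  · exact (((hψ.mono hτT).mul hE).intervalIntegrable_of_Icc hτ.1).const_mul c
  · exact ((continuousOn_const.mul (hφ.mono hτT)).mul hE).intervalIntegrable_of_Icc hτ.1
  · have hEpos : 0 ≤ Real.exp (c * ∫ x in t₀..s, φ x) := (Real.exp_pos _).le
    have h1 : ψ s ≤ φ s := hψφ s (hτT hs)
    calc c * (ψ s * Real.exp (c * ∫ x in t₀..s, φ x))
        ≤ c * (φ s * Real.exp (c * ∫ x in t₀..s, φ x)) := by gcongr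
      _ = c * φ s * Real.exp (c * ∫ x in t₀..s, φ x) := by ring

/-! ### The Hölder step -/

/-- **The Hölder step of the printed proof, endpoint form.** For `0 ≤ t₀`, `0 ≤ M`, and
nonnegative measurable `h`, `E` on `(t₀, τ)` with `√s · h(s) ≤ M` and `h² E³` integrable,
`(∫_{(t₀,τ)} (τ - s)^{-1/2} h(s) E(s) ds)³ ≤ (32/3)² M ∫_{(t₀,τ)} h² E³`: Hölder's inequality with
exponents `3/2` and `3` applied to `[(τ - s)^{-1/2} s^{-1/6}] · [s^{1/6} h E]` (the printed proof
with `p = 3`: "`∫(t-s)^{-1/2} g₂ f ≤ (∫ (t-s)^{-p'/2} g₂^{(1-2/p)p'})^{1/p'} (∫ g₂² f^p)^{1/p}`", the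
first factor "controlled by `‖s^{1/2}g₂‖_{L^∞}^{1-2/p} (∫(t-s)^{-α}s^{-β})^{1-1/p}`,
`α = p/(2(p-1))`, `β = (p-2)/(2(p-1))`"), the Abel–Beta integral `∫ (τ-s)^{-3/4} s^{-1/4} ≤ 32/3`
(`setIntegral_abel_rpow_rpow_le_of_add_eq_one`) and `(s^{1/6} h E)³ = (√s h) h² E³ ≤ M h² E³`. The
integrals are taken in `ℝ≥0∞` (`ENNReal.lintegral_mul_le_Lp_mul_Lq`), so no integrability of the
left-hand side is assumed. [cite: CoiculescuPalasek2025, App. B, proof of Lemma B.3] -/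
theorem integral_abel_mul_pow_three_le {t₀ τ M : ℝ} {h E : ℝ → ℝ} (ht₀ : 0 ≤ t₀) (hM : 0 ≤ M)
    (hhm : AEStronglyMeasurable h (volume.restrict (Ioo t₀ τ)))
    (hEm : AEStronglyMeasurable E (volume.restrict (Ioo t₀ τ)))
    (hh0 : ∀ s ∈ Ioo t₀ τ, 0 ≤ h s) (hE0 : ∀ s ∈ Ioo t₀ τ, 0 ≤ E s)
    (hhM : ∀ s ∈ Ioo t₀ τ, Real.sqrt s * h s ≤ M)
    (hint : IntegrableOn (fun s => h s ^ 2 * E s ^ 3) (Ioo t₀ τ)) :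
    (∫ s in Ioo t₀ τ, (τ - s) ^ (-(1 / 2 : ℝ)) * h s * E s) ^ 3 ≤
      (32 / 3) ^ 2 * M * ∫ s in Ioo t₀ τ, h s ^ 2 * E s ^ 3 := by
  set μ : Measure ℝ := volume.restrict (Ioo t₀ τ) with hμ
  -- the two Hölder factors
  set u : ℝ → ℝ := fun s => (τ - s) ^ (-(1 / 2 : ℝ)) * s ^ (-(1 / 6 : ℝ)) with hu
  set w : ℝ → ℝ := fun s => s ^ (1 / 6 : ℝ) * (h s * E s) with hw
  have hu0 : ∀ s ∈ Ioo t₀ τ, 0 ≤ u s := fun s hs =>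
    mul_nonneg (Real.rpow_nonneg (by linarith [hs.2]) _) (Real.rpow_nonneg (ht₀.trans hs.1.le) _)
  have hw0 : ∀ s ∈ Ioo t₀ τ, 0 ≤ w s := fun s hs =>
    mul_nonneg (Real.rpow_nonneg (ht₀.trans hs.1.le) _) (mul_nonneg (hh0 s hs) (hE0 s hs))
  have huw : ∀ s ∈ Ioo t₀ τ, (τ - s) ^ (-(1 / 2 : ℝ)) * h s * E s = u s * w s := by
    intro s hs
    have hs0 : 0 < s := ht₀.trans_lt hs.1
    have h1 : s ^ (-(1 / 6 : ℝ)) * s ^ (1 / 6 : ℝ) = 1 := by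
      rw [← Real.rpow_add hs0]
      norm_num
    simp only [hu, hw]
    calc (τ - s) ^ (-(1 / 2 : ℝ)) * h s * E s
        = (τ - s) ^ (-(1 / 2 : ℝ)) * (s ^ (-(1 / 6 : ℝ)) * s ^ (1 / 6 : ℝ)) * (h s * E s) := by
          rw [h1]; ring
      _ = (τ - s) ^ (-(1 / 2 : ℝ)) * s ^ (-(1 / 6 : ℝ)) * (s ^ (1 / 6 : ℝ) * (h s * E s)) := by
          ring
  -- measurability
  have hum : AEMeasurable u μ :=
    ((measurable_sub_rpow_const τ _).mul (measurable_id.pow_const _)).aemeasurable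
  have hwm : AEMeasurable w μ :=
    (measurable_id.pow_const _).aemeasurable.mul (hhm.aemeasurable.mul hEm.aemeasurable)
  -- the left-hand side as a lintegral
  set X : ℝ≥0∞ := ∫⁻ s in Ioo t₀ τ, ENNReal.ofReal ((τ - s) ^ (-(1 / 2 : ℝ)) * h s * E s) with hX
  have hnn : 0 ≤ᵐ[μ] fun s => (τ - s) ^ (-(1 / 2 : ℝ)) * h s * E s := by
    refine (ae_restrict_iff' measurableSet_Ioo).2 (Eventually.of_forall fun s hs => ?_)
    show (0 : ℝ) ≤ (τ - s) ^ (-(1 / 2 : ℝ)) * h s * E s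
    rw [huw s hs]
    exact mul_nonneg (hu0 s hs) (hw0 s hs)
  have hfm : AEStronglyMeasurable (fun s => (τ - s) ^ (-(1 / 2 : ℝ)) * h s * E s) μ :=
    (((measurable_sub_rpow_const τ _).aestronglyMeasurable).mul hhm).mul hEm
  have hIX : ∫ s in Ioo t₀ τ, (τ - s) ^ (-(1 / 2 : ℝ)) * h s * E s = X.toReal :=
    integral_eq_lintegral_of_nonneg_ae hnn hfm
  -- Hölder with exponents `3/2` and `3`
  have hpq : (3 / 2 : ℝ).HolderConjugate 3 :=
    Real.holderConjugate_iff.mpr ⟨by norm_num, by norm_num⟩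
  have hXeq : X = ∫⁻ s in Ioo t₀ τ,
      ((fun s => ENNReal.ofReal (u s)) * fun s => ENNReal.ofReal (w s)) s := by
    refine setLIntegral_congr_fun measurableSet_Ioo (fun s hs => ?_)
    simp only [Pi.mul_apply]
    rw [huw s hs, ENNReal.ofReal_mul (hu0 s hs)]
  have hHolder : X ≤ (∫⁻ s in Ioo t₀ τ, ENNReal.ofReal (u s) ^ (3 / 2 : ℝ)) ^ (1 / (3 / 2 : ℝ)) *
      (∫⁻ s in Ioo t₀ τ, ENNReal.ofReal (w s) ^ (3 : ℝ)) ^ (1 / (3 : ℝ)) := by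
    rw [hXeq]
    exact ENNReal.lintegral_mul_le_Lp_mul_Lq μ hpq hum.ennreal_ofReal hwm.ennreal_ofReal
  -- first factor: `u^{3/2} = (τ - s)^{-3/4} s^{-1/4}`, with integral at most `32/3`
  obtain ⟨hab_int, hab_le⟩ := setIntegral_abel_rpow_rpow_le_of_add_eq_one (a := 3 / 4)
    (b := 1 / 4) (t₀ := t₀) (τ := τ) (by norm_num) (by norm_num) (by norm_num) (by norm_num)
    (by norm_num) ht₀
  have hA : ∫⁻ s in Ioo t₀ τ, ENNReal.ofReal (u s) ^ (3 / 2 : ℝ) ≤ ENNReal.ofReal (32 / 3) := by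
    have hpt : ∀ s ∈ Ioo t₀ τ, ENNReal.ofReal (u s) ^ (3 / 2 : ℝ) =
        ENNReal.ofReal ((τ - s) ^ (-(3 / 4 : ℝ)) * s ^ (-(1 / 4 : ℝ))) := by
      intro s hs
      have hτs : 0 ≤ τ - s := by linarith [hs.2]
      have hs0 : 0 ≤ s := ht₀.trans hs.1.le
      rw [ENNReal.ofReal_rpow_of_nonneg (hu0 s hs) (by norm_num)]
      congr 1
      simp only [hu]
      rw [Real.mul_rpow (Real.rpow_nonneg hτs _) (Real.rpow_nonneg hs0 _), ← Real.rpow_mul hτs,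
        ← Real.rpow_mul hs0]
      norm_num
    calc ∫⁻ s in Ioo t₀ τ, ENNReal.ofReal (u s) ^ (3 / 2 : ℝ)
        = ∫⁻ s in Ioo t₀ τ, ENNReal.ofReal ((τ - s) ^ (-(3 / 4 : ℝ)) * s ^ (-(1 / 4 : ℝ))) :=
          setLIntegral_congr_fun measurableSet_Ioo hpt
      _ = ENNReal.ofReal (∫ s in Ioo t₀ τ, (τ - s) ^ (-(3 / 4 : ℝ)) * s ^ (-(1 / 4 : ℝ))) := by
          rw [ofReal_integral_eq_lintegral_ofReal hab_int]
          refine (ae_restrict_iff' measurableSet_Ioo).2 (Eventually.of_forall fun s hs => ?_)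
          exact mul_nonneg (Real.rpow_nonneg (by linarith [hs.2]) _)
            (Real.rpow_nonneg (ht₀.trans hs.1.le) _)
      _ ≤ ENNReal.ofReal (32 / 3) := by
          refine ENNReal.ofReal_le_ofReal (hab_le.trans ?_)
          norm_num
  -- second factor: `w³ = (√s h) h² E³ ≤ M h² E³`
  set I : ℝ := ∫ s in Ioo t₀ τ, h s ^ 2 * E s ^ 3 with hI
  have hI0 : 0 ≤ I := setIntegral_nonneg measurableSet_Ioo fun s hs =>
    mul_nonneg (sq_nonneg _) (pow_nonneg (hE0 s hs) 3)
  have hB : ∫⁻ s in Ioo t₀ τ, ENNReal.ofReal (w s) ^ (3 : ℝ) ≤ ENNReal.ofReal (M * I) := by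
    have hpt : ∀ s ∈ Ioo t₀ τ,
        ENNReal.ofReal (w s) ^ (3 : ℝ) ≤ ENNReal.ofReal (M * (h s ^ 2 * E s ^ 3)) := by
      intro s hs
      have hs0 : 0 ≤ s := ht₀.trans hs.1.le
      rw [ENNReal.ofReal_rpow_of_nonneg (hw0 s hs) (by norm_num)]
      refine ENNReal.ofReal_le_ofReal ?_
      have h3 : w s ^ (3 : ℝ) = w s ^ (3 : ℕ) := by
        rw [← Real.rpow_natCast]
        norm_num
      rw [h3]
      simp only [hw]
      have hs6 : (s ^ (1 / 6 : ℝ)) ^ (3 : ℕ) = Real.sqrt s := by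
        rw [← Real.rpow_mul_natCast hs0, Real.sqrt_eq_rpow]
        norm_num
      calc (s ^ (1 / 6 : ℝ) * (h s * E s)) ^ 3 = (s ^ (1 / 6 : ℝ)) ^ 3 * (h s * E s) ^ 3 :=
            mul_pow _ _ _
        _ = (Real.sqrt s * h s) * (h s ^ 2 * E s ^ 3) := by rw [hs6]; ring
        _ ≤ M * (h s ^ 2 * E s ^ 3) :=
            mul_le_mul_of_nonneg_right (hhM s hs)
              (mul_nonneg (sq_nonneg _) (pow_nonneg (hE0 s hs) 3))
    calc ∫⁻ s in Ioo t₀ τ, ENNReal.ofReal (w s) ^ (3 : ℝ)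
        ≤ ∫⁻ s in Ioo t₀ τ, ENNReal.ofReal (M * (h s ^ 2 * E s ^ 3)) :=
          setLIntegral_mono' measurableSet_Ioo hpt
      _ = ENNReal.ofReal (M * I) := by
          rw [hI, ← integral_const_mul, ofReal_integral_eq_lintegral_ofReal (hint.const_mul M)]
          refine (ae_restrict_iff' measurableSet_Ioo).2 (Eventually.of_forall fun s hs => ?_)
          exact mul_nonneg hM (mul_nonneg (sq_nonneg _) (pow_nonneg (hE0 s hs) 3))
  -- combine and cube
  have hX3 : X ^ 3 ≤ ENNReal.ofReal ((32 / 3) ^ 2 * M * I) := by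
    have h1 : X ≤ ENNReal.ofReal (32 / 3) ^ (1 / (3 / 2 : ℝ)) *
        ENNReal.ofReal (M * I) ^ (1 / (3 : ℝ)) := by
      refine hHolder.trans ?_
      exact mul_le_mul' (ENNReal.rpow_le_rpow hA (by norm_num))
        (ENNReal.rpow_le_rpow hB (by norm_num))
    calc X ^ 3 ≤ (ENNReal.ofReal (32 / 3) ^ (1 / (3 / 2 : ℝ)) *
          ENNReal.ofReal (M * I) ^ (1 / (3 : ℝ))) ^ 3 := by
          gcongr
      _ = ENNReal.ofReal (32 / 3) ^ ((1 / (3 / 2 : ℝ)) * (3 : ℕ)) *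
            ENNReal.ofReal (M * I) ^ ((1 / (3 : ℝ)) * (3 : ℕ)) := by
          rw [mul_pow, ENNReal.rpow_mul_natCast, ENNReal.rpow_mul_natCast]
      _ = ENNReal.ofReal (32 / 3) ^ 2 * ENNReal.ofReal (M * I) := by
          have e1 : (1 / (3 / 2 : ℝ)) * (3 : ℕ) = 2 := by norm_num
          have e2 : (1 / (3 : ℝ)) * (3 : ℕ) = 1 := by norm_num
          rw [e1, e2, ENNReal.rpow_two, ENNReal.rpow_one]
      _ = ENNReal.ofReal ((32 / 3) ^ 2 * M * I) := by
          rw [← ENNReal.ofReal_pow (by norm_num), ← ENNReal.ofReal_mul (by positivity), mul_assoc]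
  -- back to real numbers
  rw [hIX, ← ENNReal.toReal_pow]
  exact ENNReal.toReal_le_of_le_ofReal (by positivity) hX3

/-! ### The fractional Grönwall inequality -/

/-- **Fractional Grönwall inequality (Coiculescu–Palasek, Lemma B.3 with `p = 3`), constant `a`.**
Let `0 ≤ t₀ ≤ T`, `0 < a`, `0 < M`; let `f` be measurable, nonnegative and bounded on `[t₀, T]`
(no continuity is required), `g₁, g₂ ≥ 0` continuous on `[t₀, T]` with `√t · g₂(t) ≤ M`, and
suppose `f(t) ≤ a + ∫_{t₀}^t (g₁(s) + (t - s)^{-1/2} g₂(s)) f(s) ds` for all `t ∈ [t₀, T]`. Then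
`f(t) ≤ 3a · exp(3 ∫_{t₀}^t (g₁ + (8192/3) M g₂²))` on `[t₀, T]` — the printed
`f ≲_p a exp(O_p(∫g₁ + ‖s^{1/2}g₂‖^{p-2}_{L^∞} ∫g₂²))` with `p = 3`. See the module docstring for the
proof (candidate majorant `F = 3a e^{3Φ}` with `a + ∫_{t₀}^τ (g₁ + (τ-s)^{-1/2}g₂)F ≤ F(τ)/2`,
and a no-first-failure argument using that the kernel decreases in `t`). [cite: CoiculescuPalasek2025, App. B, Lemma B.3 (= arXiv Lemma 7.3)] -/
theorem fractional_gronwall_const {f g₁ g₂ : ℝ → ℝ} {t₀ T a M B : ℝ} (ht₀ : 0 ≤ t₀) (hT : t₀ ≤ T)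
    (ha : 0 < a) (hM : 0 < M)
    (hfm : AEStronglyMeasurable f (volume.restrict (Ioc t₀ T)))
    (hf0 : ∀ t ∈ Icc t₀ T, 0 ≤ f t) (hfB : ∀ t ∈ Icc t₀ T, f t ≤ B)
    (hg₁ : ContinuousOn g₁ (Icc t₀ T)) (hg₂ : ContinuousOn g₂ (Icc t₀ T))
    (hg₁0 : ∀ t ∈ Icc t₀ T, 0 ≤ g₁ t) (hg₂0 : ∀ t ∈ Icc t₀ T, 0 ≤ g₂ t)
    (hg₂M : ∀ t ∈ Icc t₀ T, Real.sqrt t * g₂ t ≤ M)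
    (hle : ∀ t ∈ Icc t₀ T,
      f t ≤ a + ∫ s in t₀..t, (g₁ s + (t - s) ^ (-(1 / 2 : ℝ)) * g₂ s) * f s) :
    ∀ t ∈ Icc t₀ T,
      f t ≤ 3 * a * Real.exp (3 * ∫ s in t₀..t, (g₁ s + 8192 / 3 * M * g₂ s ^ 2)) := by
  -- the majorant `F = 3a e^{3Φ}`, `Φ = ∫ φ`, `φ = g₁ + L g₂²`
  set L : ℝ := 8192 / 3 * M with hL
  have hL0 : 0 < L := by positivity
  set φ : ℝ → ℝ := fun s => g₁ s + L * g₂ s ^ 2 with hφ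
  set Φ : ℝ → ℝ := fun t => ∫ s in t₀..t, φ s with hΦ
  set F : ℝ → ℝ := fun t => 3 * a * Real.exp (3 * Φ t) with hF
  change ∀ t ∈ Icc t₀ T, f t ≤ F t
  have hφc : ContinuousOn φ (Icc t₀ T) := hg₁.add (continuousOn_const.mul (hg₂.pow 2))
  have hg₁φ : ∀ s ∈ Icc t₀ T, g₁ s ≤ φ s := fun s hs => by
    simp only [hφ]
    nlinarith [sq_nonneg (g₂ s), hL0.le]
  have hg₂φ : ∀ s ∈ Icc t₀ T, L * g₂ s ^ 2 ≤ φ s := fun s hs => by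
    simp only [hφ]
    linarith [hg₁0 s hs]
  have hφ0 : ∀ s ∈ Icc t₀ T, 0 ≤ φ s := fun s hs => (hg₁0 s hs).trans (hg₁φ s hs)
  have hΦc : ContinuousOn Φ (Icc t₀ T) := by
    have h := intervalIntegral.continuousOn_primitive_interval (μ := volume) (f := φ) (a := t₀)
      (b := T) (by rw [uIcc_of_le hT]; exact hφc.integrableOn_Icc)
    rwa [uIcc_of_le hT] at h
  have hΦmono : ∀ τ ∈ Icc t₀ T, ∀ t ∈ Icc t₀ T, τ ≤ t → Φ τ ≤ Φ t := by
    intro τ hτ t ht hτt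
    have hi1 : IntervalIntegrable φ volume t₀ τ :=
      (hφc.mono (Icc_subset_Icc le_rfl hτ.2)).intervalIntegrable_of_Icc hτ.1
    have hi2 : IntervalIntegrable φ volume τ t :=
      (hφc.mono (Icc_subset_Icc hτ.1 ht.2)).intervalIntegrable_of_Icc hτt
    have hsum := intervalIntegral.integral_add_adjacent_intervals hi1 hi2
    have hnn : 0 ≤ ∫ s in τ..t, φ s :=
      intervalIntegral.integral_nonneg hτt fun s hs => hφ0 s ⟨hτ.1.trans hs.1, hs.2.trans ht.2⟩
    simp only [hΦ]
    linarith
  have hΦ0 : ∀ t ∈ Icc t₀ T, 0 ≤ Φ t := by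
    intro t ht
    have h := hΦmono t₀ ⟨le_rfl, hT⟩ t ht ht.1
    simp only [hΦ, intervalIntegral.integral_same] at h
    exact h
  have hFc : ContinuousOn F (Icc t₀ T) :=
    continuousOn_const.mul (Real.continuous_exp.comp_continuousOn (hΦc.const_smul (3 : ℝ)))
  have hF0 : ∀ t ∈ Icc t₀ T, 0 ≤ F t := fun t ht => by
    simp only [hF]; positivity
  have hF3a : ∀ t ∈ Icc t₀ T, 3 * a ≤ F t := fun t ht => by
    simp only [hF]
    have : 1 ≤ Real.exp (3 * Φ t) := Real.one_le_exp (by linarith [hΦ0 t ht])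
    nlinarith
  have hFmono : ∀ τ ∈ Icc t₀ T, ∀ t ∈ Icc t₀ T, τ ≤ t → F τ ≤ F t := by
    intro τ hτ t ht hτt
    simp only [hF]
    have := Real.exp_le_exp.2 (show 3 * Φ τ ≤ 3 * Φ t by linarith [hΦmono τ hτ t ht hτt])
    nlinarith
  -- bounds for `g₁`, `g₂`, `F` on the compact interval
  obtain ⟨G₁, hG₁⟩ := isCompact_Icc.exists_bound_of_continuousOn hg₁
  obtain ⟨G₂, hG₂⟩ := isCompact_Icc.exists_bound_of_continuousOn hg₂
  obtain ⟨CF, hCF⟩ := isCompact_Icc.exists_bound_of_continuousOn hFc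
  have ht₀m : t₀ ∈ Icc t₀ T := ⟨le_rfl, hT⟩
  have hG₁0 : 0 ≤ G₁ := (norm_nonneg _).trans (hG₁ t₀ ht₀m)
  have hG₂0 : 0 ≤ G₂ := (norm_nonneg _).trans (hG₂ t₀ ht₀m)
  have hB0 : 0 ≤ B := (hf0 t₀ ht₀m).trans (hfB t₀ ht₀m)
  -- integrability of the memory integrands on subintervals
  have hKint : ∀ (ψ : ℝ → ℝ) (C : ℝ), AEStronglyMeasurable ψ (volume.restrict (Ioc t₀ T)) →
      (∀ s ∈ Ioc t₀ T, ‖ψ s‖ ≤ C) → ∀ t ∈ Icc t₀ T, ∀ c d : ℝ, t₀ ≤ c → c ≤ d → d ≤ t →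
      IntervalIntegrable (fun s => (g₁ s + (t - s) ^ (-(1 / 2 : ℝ)) * g₂ s) * ψ s) volume c d := by
    intro ψ C hψm hψC t ht c d hc hcd hdt
    rw [intervalIntegrable_iff_integrableOn_Ioc_of_le hcd]
    have hsub : Ioc c d ⊆ Ioc t₀ T := Ioc_subset_Ioc hc (hdt.trans ht.2)
    have hsub' : Ioc c d ⊆ Icc t₀ T := hsub.trans Ioc_subset_Icc_self
    -- the majorant `(G₁ + (t - s)^{-1/2} G₂) C`
    have hker : IntegrableOn (fun s : ℝ => (t - s) ^ (-(1 / 2 : ℝ))) (Ioc c d) := by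
      have h1 : IntegrableOn (fun s : ℝ => (t - s) ^ (-(1 / 2 : ℝ))) (Ioo c t) :=
        integrableOn_sub_rpow_Ioo (by norm_num)
      have h2 : IntegrableOn (fun s : ℝ => (t - s) ^ (-(1 / 2 : ℝ))) (Ioc c t) :=
        h1.congr_set_ae Ioo_ae_eq_Ioc.symm
      exact h2.mono_set (Ioc_subset_Ioc le_rfl hdt)
    have hmaj : IntegrableOn (fun s : ℝ => (G₁ + (t - s) ^ (-(1 / 2 : ℝ)) * G₂) * C) (Ioc c d) :=
      ((integrableOn_const (measure_Ioc_lt_top.ne)).add (hker.mul_const G₂)).mul_const C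
    have hmeas : AEStronglyMeasurable (fun s => (g₁ s + (t - s) ^ (-(1 / 2 : ℝ)) * g₂ s) * ψ s)
        (volume.restrict (Ioc c d)) := by
      refine AEStronglyMeasurable.mul ?_ (hψm.mono_measure (Measure.restrict_mono hsub le_rfl))
      refine ((hg₁.mono hsub').aestronglyMeasurable measurableSet_Ioc).add ?_
      exact ((measurable_sub_rpow_const t _).aestronglyMeasurable).mul
        ((hg₂.mono hsub').aestronglyMeasurable measurableSet_Ioc)
    refine hmaj.mono' hmeas ?_
    refine (ae_restrict_iff' measurableSet_Ioc).2 (Eventually.of_forall fun s hs => ?_)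
    have hs' : s ∈ Icc t₀ T := hsub' hs
    have hk0 : 0 ≤ (t - s) ^ (-(1 / 2 : ℝ)) := Real.rpow_nonneg (by linarith [hs.2]) _
    have hC0 : 0 ≤ C := (norm_nonneg _).trans (hψC s (hsub hs))
    rw [norm_mul]
    refine mul_le_mul ?_ (hψC s (hsub hs)) (norm_nonneg _) (by positivity)
    calc ‖g₁ s + (t - s) ^ (-(1 / 2 : ℝ)) * g₂ s‖
        ≤ ‖g₁ s‖ + ‖(t - s) ^ (-(1 / 2 : ℝ)) * g₂ s‖ := norm_add_le _ _
      _ = ‖g₁ s‖ + (t - s) ^ (-(1 / 2 : ℝ)) * ‖g₂ s‖ := by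
          rw [norm_mul, Real.norm_of_nonneg hk0]
      _ ≤ G₁ + (t - s) ^ (-(1 / 2 : ℝ)) * G₂ := by
          gcongr
          · exact hG₁ s hs'
          · exact hG₂ s hs'
  have hfm' : ∀ s ∈ Ioc t₀ T, ‖f s‖ ≤ B := fun s hs => by
    rw [Real.norm_of_nonneg (hf0 s (Ioc_subset_Icc_self hs))]
    exact hfB s (Ioc_subset_Icc_self hs)
  have hFm : AEStronglyMeasurable F (volume.restrict (Ioc t₀ T)) :=
    (hFc.mono Ioc_subset_Icc_self).aestronglyMeasurable measurableSet_Ioc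
  have hFm' : ∀ s ∈ Ioc t₀ T, ‖F s‖ ≤ CF := fun s hs => hCF s (Ioc_subset_Icc_self hs)
  -- the core estimate: `a + ∫_{t₀}^τ (g₁ + (τ - s)^{-1/2} g₂) F ≤ F(τ)/2`
  have hcore : ∀ τ ∈ Icc t₀ T,
      a + ∫ s in t₀..τ, (g₁ s + (τ - s) ^ (-(1 / 2 : ℝ)) * g₂ s) * F s ≤ F τ / 2 := by
    intro τ hτ
    have hτT : Icc t₀ τ ⊆ Icc t₀ T := Icc_subset_Icc le_rfl hτ.2
    -- (A) the regular part
    have hiA : IntervalIntegrable (fun s => g₁ s * F s) volume t₀ τ :=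
      ((hg₁.mono hτT).mul (hFc.mono hτT)).intervalIntegrable_of_Icc hτ.1
    have hA : ∫ s in t₀..τ, g₁ s * F s ≤ a * (Real.exp (3 * Φ τ) - 1) := by
      have h := integral_mul_exp_primitive_le (c := 3) hφc hg₁ hg₁φ hτ (by norm_num)
      calc ∫ s in t₀..τ, g₁ s * F s
          = 3 * a * ∫ s in t₀..τ, g₁ s * Real.exp (3 * Φ s) := by
            rw [← intervalIntegral.integral_const_mul]
            refine intervalIntegral.integral_congr fun s _ => ?_
            simp only [hF]
            ring
        _ ≤ 3 * a * ((Real.exp (3 * Φ τ) - 1) / 3) := by gcongr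
        _ = a * (Real.exp (3 * Φ τ) - 1) := by ring
    -- (B) the singular part, by the Hölder step
    have hiB : IntervalIntegrable (fun s => (τ - s) ^ (-(1 / 2 : ℝ)) * g₂ s * F s) volume t₀ τ := by
      have h := hKint F CF hFm hFm' τ hτ t₀ τ le_rfl hτ.1 le_rfl
      have h0 := hiA
      have hdiff := h.sub h0
      refine hdiff.congr ?_
      -- pointwise identity on the interval of integration
      refine fun s _ => ?_
      show (g₁ s + (τ - s) ^ (-(1 / 2 : ℝ)) * g₂ s) * F s - g₁ s * F s =
        (τ - s) ^ (-(1 / 2 : ℝ)) * g₂ s * F s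
      ring
    have hB : ∫ s in t₀..τ, (τ - s) ^ (-(1 / 2 : ℝ)) * g₂ s * F s ≤ F τ / 6 := by
      -- the cube bound
      have hI3 : IntegrableOn (fun s => g₂ s ^ 2 * F s ^ 3) (Ioo t₀ τ) :=
        (((hg₂.mono hτT).pow 2).mul ((hFc.mono hτT).pow 3)).integrableOn_Icc.mono_set
          Ioo_subset_Icc_self
      have hcube := integral_abel_mul_pow_three_le (h := g₂) (E := F) (τ := τ) ht₀ hM.le
        ((hg₂.mono (Ioo_subset_Icc_self.trans hτT)).aestronglyMeasurable measurableSet_Ioo)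
        ((hFc.mono (Ioo_subset_Icc_self.trans hτT)).aestronglyMeasurable measurableSet_Ioo)
        (fun s hs => hg₂0 s (hτT (Ioo_subset_Icc_self hs)))
        (fun s hs => hF0 s (hτT (Ioo_subset_Icc_self hs)))
        (fun s hs => hg₂M s (hτT (Ioo_subset_Icc_self hs))) hI3
      -- `∫ g₂² F³ ≤ 27 a³ e^{9Φ(τ)}/(9L) ≤ 3 a³ e^{9Φ(τ)}/L`
      have hexp3 : ∀ s, Real.exp (3 * Φ s) ^ 3 = Real.exp (9 * Φ s) := fun s => by
        rw [← Real.exp_nat_mul]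
        congr 1
        push_cast
        ring
      have hI9 : ∫ s in Ioo t₀ τ, g₂ s ^ 2 * F s ^ 3 ≤ 3 * a ^ 3 * Real.exp (9 * Φ τ) / L := by
        have h : ∫ s in t₀..τ, L * g₂ s ^ 2 * Real.exp (9 * Φ s) ≤
            (Real.exp (9 * Φ τ) - 1) / 9 :=
          integral_mul_exp_primitive_le (c := 9) hφc (continuousOn_const.mul (hg₂.pow 2))
            hg₂φ hτ (by norm_num)
        have e3 : ∀ s, g₂ s ^ 2 * F s ^ 3 =
            (27 * a ^ 3 / L) * (L * g₂ s ^ 2 * Real.exp (9 * Φ s)) := fun s => by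
          simp only [hF]
          rw [mul_pow, hexp3 s]
          field_simp
          ring
        rw [← integral_Ioc_eq_integral_Ioo, ← intervalIntegral.integral_of_le hτ.1]
        have h27 : 0 ≤ 27 * a ^ 3 / L := by positivity
        calc ∫ s in t₀..τ, g₂ s ^ 2 * F s ^ 3
            = (27 * a ^ 3 / L) * ∫ s in t₀..τ, L * g₂ s ^ 2 * Real.exp (9 * Φ s) := by
              rw [← intervalIntegral.integral_const_mul]
              exact intervalIntegral.integral_congr fun s _ => e3 s
          _ ≤ (27 * a ^ 3 / L) * ((Real.exp (9 * Φ τ) - 1) / 9) :=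
              mul_le_mul_of_nonneg_left h h27
          _ = 3 * a ^ 3 * Real.exp (9 * Φ τ) / L - 3 * a ^ 3 / L := by
              field_simp
              ring
          _ ≤ 3 * a ^ 3 * Real.exp (9 * Φ τ) / L := by
              have : 0 ≤ 3 * a ^ 3 / L := by positivity
              linarith
      -- hence `J³ ≤ (a e^{3Φ(τ)}/2)³`
      set J : ℝ := ∫ s in Ioo t₀ τ, (τ - s) ^ (-(1 / 2 : ℝ)) * g₂ s * F s with hJ
      have hJ3 : J ^ 3 ≤ (a * Real.exp (3 * Φ τ) / 2) ^ 3 := by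
        calc J ^ 3 ≤ (32 / 3) ^ 2 * M * ∫ s in Ioo t₀ τ, g₂ s ^ 2 * F s ^ 3 := hcube
          _ ≤ (32 / 3) ^ 2 * M * (3 * a ^ 3 * Real.exp (9 * Φ τ) / L) :=
              mul_le_mul_of_nonneg_left hI9 (by positivity)
          _ = (a * Real.exp (3 * Φ τ) / 2) ^ 3 := by
              rw [← hexp3 τ, hL]
              field_simp
              ring
      have hJle : J ≤ a * Real.exp (3 * Φ τ) / 2 :=
        le_of_pow_le_pow_left₀ (by norm_num) (by positivity) hJ3
      rw [intervalIntegral.integral_of_le hτ.1, integral_Ioc_eq_integral_Ioo]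
      calc J ≤ a * Real.exp (3 * Φ τ) / 2 := hJle
        _ = F τ / 6 := by simp only [hF]; ring
    -- sum of the two parts
    have hsplitF : ∫ s in t₀..τ, (g₁ s + (τ - s) ^ (-(1 / 2 : ℝ)) * g₂ s) * F s =
        (∫ s in t₀..τ, g₁ s * F s) + ∫ s in t₀..τ, (τ - s) ^ (-(1 / 2 : ℝ)) * g₂ s * F s := by
      rw [← intervalIntegral.integral_add hiA hiB]
      refine intervalIntegral.integral_congr fun s _ => ?_
      ring
    rw [hsplitF]
    have : a + (a * (Real.exp (3 * Φ τ) - 1) + F τ / 6) = F τ / 2 := by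
      simp only [hF]
      ring
    linarith [hA, hB]
  -- the uniform step size `δ = r²`, `Q r ≤ 3a/2`, `r ≤ 1`
  set Q : ℝ := B * (G₁ + 2 * G₂) + 1 with hQ
  have hQ0 : 0 < Q := by positivity
  set r : ℝ := min 1 (3 * a / 2 / Q) with hr
  have hr0 : 0 < r := lt_min one_pos (by positivity)
  have hr1 : r ≤ 1 := min_le_left _ _
  have hrQ : Q * r ≤ 3 * a / 2 := by
    calc Q * r ≤ Q * (3 * a / 2 / Q) := mul_le_mul_of_nonneg_left (min_le_right _ _) hQ0.le
      _ = 3 * a / 2 := by field_simp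
  set δ : ℝ := r ^ 2 with hδ
  have hδ0 : 0 < δ := by positivity
  have hδr : δ ≤ r := by
    rw [hδ]
    nlinarith
  have hsqrtδ : δ ^ (1 / 2 : ℝ) = r := by
    rw [← Real.sqrt_eq_rpow, hδ, Real.sqrt_sq hr0.le]
  -- the step: if `f ≤ F` on `[t₀, τ)` then `f ≤ F` on `[τ, τ + δ] ∩ [t₀, T]`
  have hstep : ∀ τ ∈ Icc t₀ T, (∀ s ∈ Ico t₀ τ, f s ≤ F s) →
      ∀ t ∈ Icc t₀ T, τ ≤ t → t ≤ τ + δ → f t ≤ F t := by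
    intro τ hτ hind t ht hτt htδ
    have hi1 : IntervalIntegrable (fun s => (g₁ s + (t - s) ^ (-(1 / 2 : ℝ)) * g₂ s) * f s)
        volume t₀ τ := hKint f B hfm hfm' t ht t₀ τ le_rfl hτ.1 hτt
    have hi2 : IntervalIntegrable (fun s => (g₁ s + (t - s) ^ (-(1 / 2 : ℝ)) * g₂ s) * f s)
        volume τ t := hKint f B hfm hfm' t ht τ t hτ.1 hτt le_rfl
    have hsplit : ∫ s in t₀..t, (g₁ s + (t - s) ^ (-(1 / 2 : ℝ)) * g₂ s) * f s =
        (∫ s in t₀..τ, (g₁ s + (t - s) ^ (-(1 / 2 : ℝ)) * g₂ s) * f s) +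
          ∫ s in τ..t, (g₁ s + (t - s) ^ (-(1 / 2 : ℝ)) * g₂ s) * f s :=
      (intervalIntegral.integral_add_adjacent_intervals hi1 hi2).symm
    -- part 1: the memory over `[t₀, τ)`; the kernel decreases in `t`
    have hiF : IntervalIntegrable (fun s => (g₁ s + (τ - s) ^ (-(1 / 2 : ℝ)) * g₂ s) * F s)
        volume t₀ τ := hKint F CF hFm hFm' τ hτ t₀ τ le_rfl hτ.1 le_rfl
    have h1 : ∫ s in t₀..τ, (g₁ s + (t - s) ^ (-(1 / 2 : ℝ)) * g₂ s) * f s ≤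
        ∫ s in t₀..τ, (g₁ s + (τ - s) ^ (-(1 / 2 : ℝ)) * g₂ s) * F s := by
      refine intervalIntegral.integral_mono_on_of_le_Ioo hτ.1 hi1 hiF fun s hs => ?_
      have hs' : s ∈ Icc t₀ T := ⟨hs.1.le, hs.2.le.trans hτ.2⟩
      have hfF : f s ≤ F s := hind s ⟨hs.1.le, hs.2⟩
      have hkt : (t - s) ^ (-(1 / 2 : ℝ)) ≤ (τ - s) ^ (-(1 / 2 : ℝ)) :=
        Real.rpow_le_rpow_of_nonpos (by linarith [hs.2]) (by linarith) (by norm_num)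
      have hkt0 : 0 ≤ (t - s) ^ (-(1 / 2 : ℝ)) := Real.rpow_nonneg (by linarith [hs.2]) _
      have hk0 : 0 ≤ g₁ s + (t - s) ^ (-(1 / 2 : ℝ)) * g₂ s :=
        add_nonneg (hg₁0 s hs') (mul_nonneg hkt0 (hg₂0 s hs'))
      have hkk : g₁ s + (t - s) ^ (-(1 / 2 : ℝ)) * g₂ s ≤ g₁ s + (τ - s) ^ (-(1 / 2 : ℝ)) * g₂ s :=
        add_le_add le_rfl (mul_le_mul_of_nonneg_right hkt (hg₂0 s hs'))
      exact mul_le_mul hkk hfF (hf0 s hs') (hk0.trans hkk)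
    -- part 2: the fresh part over `[τ, t]` is `O(√δ)`
    have hker : IntegrableOn (fun s : ℝ => (t - s) ^ (-(1 / 2 : ℝ))) (Ioc τ t) :=
      (integrableOn_sub_rpow_Ioo (a := τ) (t := t) (by norm_num)).congr_set_ae
        Ioo_ae_eq_Ioc.symm
    have hmaj2 : IntervalIntegrable (fun s => (G₁ + (t - s) ^ (-(1 / 2 : ℝ)) * G₂) * B)
        volume τ t := by
      rw [intervalIntegrable_iff_integrableOn_Ioc_of_le hτt]
      exact ((integrableOn_const (measure_Ioc_lt_top.ne)).add (hker.mul_const G₂)).mul_const B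
    have h2 : ∫ s in τ..t, (g₁ s + (t - s) ^ (-(1 / 2 : ℝ)) * g₂ s) * f s ≤ 3 * a / 2 := by
      have hkerint : ∫ s in τ..t, (t - s) ^ (-(1 / 2 : ℝ)) = 2 * (t - τ) ^ (1 / 2 : ℝ) := by
        rw [intervalIntegral.integral_of_le hτt, integral_Ioc_eq_integral_Ioo,
          setIntegral_Ioo_sub_rpow_neg_half hτt]
      have hkeri : IntervalIntegrable (fun s : ℝ => (t - s) ^ (-(1 / 2 : ℝ))) volume τ t := by
        rwa [intervalIntegrable_iff_integrableOn_Ioc_of_le hτt]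
      have htτ : (t - τ) ^ (1 / 2 : ℝ) ≤ r := by
        rw [← hsqrtδ]
        exact Real.rpow_le_rpow (by linarith) (by linarith) (by norm_num)
      have htτ' : t - τ ≤ r := by linarith
      calc ∫ s in τ..t, (g₁ s + (t - s) ^ (-(1 / 2 : ℝ)) * g₂ s) * f s
          ≤ ∫ s in τ..t, (G₁ + (t - s) ^ (-(1 / 2 : ℝ)) * G₂) * B := by
            refine intervalIntegral.integral_mono_on hτt hi2 hmaj2 fun s hs => ?_
            have hs' : s ∈ Icc t₀ T := ⟨hτ.1.trans hs.1, hs.2.trans ht.2⟩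
            have hkt0 : 0 ≤ (t - s) ^ (-(1 / 2 : ℝ)) := Real.rpow_nonneg (by linarith [hs.2]) _
            have hg1 : g₁ s ≤ G₁ := (le_abs_self _).trans (hG₁ s hs')
            have hg2 : g₂ s ≤ G₂ := (le_abs_self _).trans (hG₂ s hs')
            have hkk : g₁ s + (t - s) ^ (-(1 / 2 : ℝ)) * g₂ s ≤ G₁ + (t - s) ^ (-(1 / 2 : ℝ)) * G₂ :=
              add_le_add hg1 (mul_le_mul_of_nonneg_left hg2 hkt0)
            exact mul_le_mul hkk (hfB s hs') (hf0 s hs') (by positivity)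
        _ = (G₁ * (t - τ) + 2 * (t - τ) ^ (1 / 2 : ℝ) * G₂) * B := by
            rw [intervalIntegral.integral_mul_const, intervalIntegral.integral_add
              intervalIntegrable_const (hkeri.mul_const G₂), intervalIntegral.integral_const,
              intervalIntegral.integral_mul_const, hkerint, smul_eq_mul, mul_comm (t - τ) G₁]
        _ ≤ (G₁ * r + 2 * r * G₂) * B := by gcongr
        _ = (Q - 1) * r := by simp only [hQ]; ring
        _ ≤ Q * r := by nlinarith
        _ ≤ 3 * a / 2 := hrQ
    -- combine
    have h3a : 3 * a / 2 ≤ F τ / 2 := by linarith [hF3a τ hτ]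
    calc f t ≤ a + ∫ s in t₀..t, (g₁ s + (t - s) ^ (-(1 / 2 : ℝ)) * g₂ s) * f s := hle t ht
      _ ≤ (a + ∫ s in t₀..τ, (g₁ s + (τ - s) ^ (-(1 / 2 : ℝ)) * g₂ s) * F s) + 3 * a / 2 := by
          rw [hsplit]; linarith
      _ ≤ F τ / 2 + F τ / 2 := add_le_add (hcore τ hτ) h3a
      _ = F τ := by ring
      _ ≤ F t := hFmono τ hτ t ht hτt
  -- no first failure: `sup {τ ∈ [t₀, T] : f ≤ F on [t₀, τ]} = T`
  set Gd : Set ℝ := {τ | τ ∈ Icc t₀ T ∧ ∀ s ∈ Icc t₀ τ, f s ≤ F s} with hGd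
  have ht₀G : t₀ ∈ Gd := by
    refine ⟨ht₀m, fun s hs => ?_⟩
    have hst : s = t₀ := le_antisymm hs.2 hs.1
    subst hst
    exact hstep s ht₀m (fun x hx => absurd hx.2 (not_lt.2 hx.1)) s ht₀m le_rfl (by linarith)
  have hGne : Gd.Nonempty := ⟨t₀, ht₀G⟩
  have hGbdd : BddAbove Gd := ⟨T, fun τ hτ => hτ.1.2⟩
  set τs : ℝ := sSup Gd with hτs
  have hτs_mem : τs ∈ Icc t₀ T := ⟨le_csSup hGbdd ht₀G, csSup_le hGne fun τ hτ => hτ.1.2⟩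
  have hleft : ∀ s ∈ Ico t₀ τs, f s ≤ F s := by
    intro s hs
    obtain ⟨τ, hτG, hsτ⟩ := exists_lt_of_lt_csSup hGne hs.2
    exact hτG.2 s ⟨hs.1, hsτ.le⟩
  set t₁ : ℝ := min (τs + δ) T with ht₁
  have ht₁G : t₁ ∈ Gd := by
    refine ⟨⟨le_min (by linarith [hτs_mem.1]) hT, min_le_right _ _⟩, fun s hs => ?_⟩
    rcases lt_or_ge s τs with h | h
    · exact hleft s ⟨hs.1, h⟩
    · exact hstep τs hτs_mem hleft s ⟨hs.1, hs.2.trans (min_le_right _ _)⟩ h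
        (hs.2.trans (min_le_left _ _))
  have ht₁le : t₁ ≤ τs := le_csSup hGbdd ht₁G
  have hTτ : T ≤ τs := by
    by_contra hlt
    have hlt' : τs < T := lt_of_not_ge hlt
    have : τs < t₁ := lt_min (by linarith) hlt'
    linarith
  have ht₁T : t₁ = T := min_eq_right (by linarith)
  have hTG : T ∈ Gd := ht₁T ▸ ht₁G
  exact fun t ht => hTG.2 t ht

/-- **Fractional Grönwall inequality (Coiculescu–Palasek, Lemma B.3 with `p = 3`).** Let
`0 ≤ t₀ ≤ T` and `0 < M`; let `f` be measurable, nonnegative and bounded on `[t₀, T]` (no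
continuity is required), `g₁, g₂ ≥ 0` continuous on `[t₀, T]` with `√t · g₂(t) ≤ M`, and `a ≥ 0`
non-decreasing on `[t₀, T]`, and suppose
`f(t) ≤ a(t) + ∫_{t₀}^t (g₁(s) + (t - s)^{-1/2} g₂(s)) f(s) ds` for all `t ∈ [t₀, T]`. Then
`f(t) ≤ 3 a(t) · exp(3 ∫_{t₀}^t (g₁ + (8192/3) M g₂²))` on `[t₀, T]`: the printed
`f(t) ≲_p a(t) exp(O_p(∫_{t₀}^t g₁ + ‖s^{1/2} g₂‖^{p-2}_{L^∞([t₀,t])} ∫_{t₀}^t g₂²))` with `p = 3`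
(with a constant bound `M` for `s^{1/2} g₂` on the whole interval in place of the running
`L^∞([t₀,t])` norm — apply the theorem on `[t₀, t]` to recover the printed form). Reduction to
`fractional_gronwall_const`, exactly as printed: "Fix any `T > 0`. We have
`f(t) ≤ a(T) + …` for all `t ∈ [t₀, T]`. We may apply the constant version … In particular, this
holds at `t = T`"; the case `a(T) = 0` by letting the constant tend to `0`. [cite: CoiculescuPalasek2025, App. B, Lemma B.3 (= arXiv Lemma 7.3)] -/
theorem fractional_gronwall {f g₁ g₂ a : ℝ → ℝ} {t₀ T M B : ℝ} (ht₀ : 0 ≤ t₀) (hM : 0 < M)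
    (hfm : AEStronglyMeasurable f (volume.restrict (Ioc t₀ T)))
    (hf0 : ∀ t ∈ Icc t₀ T, 0 ≤ f t) (hfB : ∀ t ∈ Icc t₀ T, f t ≤ B)
    (hg₁ : ContinuousOn g₁ (Icc t₀ T)) (hg₂ : ContinuousOn g₂ (Icc t₀ T))
    (hg₁0 : ∀ t ∈ Icc t₀ T, 0 ≤ g₁ t) (hg₂0 : ∀ t ∈ Icc t₀ T, 0 ≤ g₂ t)
    (hg₂M : ∀ t ∈ Icc t₀ T, Real.sqrt t * g₂ t ≤ M)
    (ha0 : ∀ t ∈ Icc t₀ T, 0 ≤ a t) (hamono : MonotoneOn a (Icc t₀ T))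
    (hle : ∀ t ∈ Icc t₀ T,
      f t ≤ a t + ∫ s in t₀..t, (g₁ s + (t - s) ^ (-(1 / 2 : ℝ)) * g₂ s) * f s) :
    ∀ t ∈ Icc t₀ T,
      f t ≤ 3 * a t * Real.exp (3 * ∫ s in t₀..t, (g₁ s + 8192 / 3 * M * g₂ s ^ 2)) := by
  intro τ hτ
  set Eτ : ℝ := Real.exp (3 * ∫ s in t₀..τ, (g₁ s + 8192 / 3 * M * g₂ s ^ 2)) with hEτ
  have hE0 : 0 < Eτ := Real.exp_pos _
  -- restrict everything to `[t₀, τ]`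
  have hτT : Icc t₀ τ ⊆ Icc t₀ T := Icc_subset_Icc le_rfl hτ.2
  have hfmτ : AEStronglyMeasurable f (volume.restrict (Ioc t₀ τ)) :=
    hfm.mono_measure (Measure.restrict_mono (Ioc_subset_Ioc le_rfl hτ.2) le_rfl)
  refine le_of_forall_pos_le_add fun ε hε => ?_
  -- the constant version with `a' = a(τ) + ε/(3 E_τ) > 0`
  set a' : ℝ := a τ + ε / (3 * Eτ) with ha'
  have ha'0 : 0 < a' := add_pos_of_nonneg_of_pos (ha0 τ hτ) (by positivity)
  have hle' : ∀ t ∈ Icc t₀ τ,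
      f t ≤ a' + ∫ s in t₀..t, (g₁ s + (t - s) ^ (-(1 / 2 : ℝ)) * g₂ s) * f s := by
    intro t ht
    have h1 := hle t (hτT ht)
    have h2 : a t ≤ a τ := hamono (hτT ht) hτ ht.2
    have h3 : a τ ≤ a' := le_add_of_nonneg_right (by positivity)
    linarith
  have h := fractional_gronwall_const ht₀ hτ.1 ha'0 hM hfmτ (fun t ht => hf0 t (hτT ht))
    (fun t ht => hfB t (hτT ht)) (hg₁.mono hτT) (hg₂.mono hτT) (fun t ht => hg₁0 t (hτT ht))
    (fun t ht => hg₂0 t (hτT ht)) (fun t ht => hg₂M t (hτT ht)) hle' τ ⟨hτ.1, le_rfl⟩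
  calc f τ ≤ 3 * a' * Eτ := h
    _ = 3 * a τ * Eτ + ε := by
        simp only [ha']
        field_simp

end Literature.Analysis.FluidPDE
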